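import Summits.BirchSwinnertonDyer.BirchSwinnertonDyer.Theorems.CongruentShaFreeCutLambdaSupplyAllPrimes
import Summits.BirchSwinnertonDyer.Rank1Residual.X11b.CharacterSupply
import HarnessLib

set_option linter.dupNamespace false
set_option autoImplicit false

/-!
# Route `CongruentShaFreeCut` (rung S2) — crux `AnalyticRankOneOfRankOneFiniteShaTwo`
(stmt-BirchSwinnertonDyer-19080), line `two-adic-bdp-triple` (v5b): the ANTICYCLOTOMIC CHARACTER
SUPPLY and FRAME RIGIDITY of the BDP frame `IsBDPLFunction` AT EVERY PRIME `p`, IN PARTICULAR AT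
`p = 2` — the `p ≠ 2` hypothesis of the tree's `LambdaSupply.exists_interpolationCharacter`,
`X11b.characterSupplyAt`, `X11b.isBDPLFunction_unique`, `X11b.isBDPLFunction_forall_of_exists`,
`X11b.R1.isBDPLFunctionInt_unique`, `X11b.R1.isBDPLFunctionInt_forall_of_exists` REMOVED (file 2 of 2
of the `p = 2` character-supply port; file 1 = `Theorems/CongruentShaFreeCutLambdaSupplyAllPrimes.lean`)

Cell `bsd-cn100`, prover seat `bsd-cn100-transfer` (g8), executing the plan seat's PORT NOTE
(`HOME/bsd-cn100-plan/routes-g11/kit/P2-CHARACTER-SUPPLY-PORT-NOTE.md`, 2026-08-26T10:3xZ). Supports,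
does not close, stmt-BirchSwinnertonDyer-19080. HONEST FRAMING: nothing here proves crux B, Link B,
the three BDP-currency statements (LB-exist)/(LB-wan)/(LB-bdp) of
`Theorems/CongruentShaFreeCutTwoAdicBDPTriple.lean`, the leaf `rankOne_twoConverse_congruentNumber`
or any case of BSD. It is a SUPPORT LEMMA: it certifies in the kernel that at `p = 2` the BDP frame
`IsBDPLFunction ι' v κ γ f Ω_K Ω_p ·` quantified over in (LB-wan)/(LB-bdp) is RIGID (two elements of
one frame coincide: `twoAdic_isBDPLFunction_unique`), so that those `∀ L`-statements speak about ONE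
series per `(ι', Ω_K, Ω_p)` as soon as (LB-exist) supplies one (`twoAdic_isBDPLFunction_forall_of_exists`)
— exactly as at odd `p` — and it supplies the interpolation characters any future proof of
(LB-wan)/(LB-bdp) in `∀`-form consumes (`twoAdic_characterSupplyAt`).

## Contents (every prime `p`; the proofs are multr1-p2 / multr1-p1's VERBATIM over file 1's
type-`(m₀,−m₀)` λ-supply `lambdaSupplyPowAt`, with `m := m₀·M`)

* §2 `exists_interpolationCharacter` (`φ` unramified everywhere of type `(m,−m)`, `m > 0`, avatar
  through `κ`, `‖ψ(γ) − 1‖ < 1`, `ψ(γ)^{p^k} ≠ 1`), `characterSupplyAt` (the two sequences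
  `φ₀^{p^k}`, `φ₀^{2p^k}` in x11b3's S27 binder shape).
* §3 `exists_supply_tendsto`, `isBDPLFunction_unique`, `isBDPLFunction_forall_of_exists`,
  `isBDPLFunctionInt_unique`, `isBDPLFunctionInt_forall_of_exists` (frame rigidity at fixed periods,
  over `R₀⟦T⟧` and over `𝓞_{ℂ_p}⟦T⟧`, via multr1-p1's `isBDPLFunction_unique_of_tendsto` /
  `R1.isBDPLFunctionInt_unique_of_tendsto`).
* §4 the `p = 2` instances in the currency of the v5b line (`[Fact (κ.IsTopGenerator γ)]` as there):
  `twoAdic_isBDPLFunction_unique`, `twoAdic_isBDPLFunction_forall_of_exists`, `twoAdic_characterSupplyAt`.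
New constants live in THIS namespace; the tree's odd-`p` constants are untouched and stay of record
at odd `p`.

PROVENANCE / CREDIT: team x11b3 (`X11b/Three/*`, seats `b2b-bsdres-x11b3-p2/p3/p7`), sub-cells
multr1-p2 (`X11b/InterpolationCharacterSupply.lean`) and multr1-p1 (`X11b/CharacterSupply.lean`,
`X11b/BDPFrameUniqueness(Int).lean`); every lemma is IMPORTED, not restated.

## References

* [Castella2018] F. Castella, Math. Ann. 370 (2018), Thm. 3.1 (the interpolation range `(n,−n)`,
  `n > 0`, `φ` unramified; arXiv:1704.06608 p. 9).
* [CastellaHsieh2018] §3.3, Def. 3.5, Prop. 3.6.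
* [Hsieh2014] M.-L. Hsieh, Doc. Math. 19 (2014), p. 7 (arXiv:1112.1580) (the receptacle).
* [Washington1997] L. C. Washington, *Introduction to Cyclotomic Fields*, §5.1, §13.1.
* [Greenberg1987] R. Greenberg, *Non-vanishing of certain values of `L`-functions*, §2.
* [Weil1956] A. Weil, *On a certain type of characters of the idèle-class group*, §1–§2.
-/

noncomputable section

open scoped NumberField Classical Topology
open NumberField IsDedekindDomain Field Filter Topology Polynomial PowerSeries
  Literature.NumberTheory.GaloisRepresentations Literature.NumberTheory.EllipticCurves
  Literature.NumberTheory.Automorphic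

namespace Summit.BirchSwinnertonDyer.BirchSwinnertonDyer.Theorems.CongruentShaFreeCutCharacterSupply

open Summit.BirchSwinnertonDyer.Rank1Residual.X11b.Three.LambdaSupply
open Summit.BirchSwinnertonDyer.Rank1Residual.X11b.Three.LambdaSupply.PadicUnits
open Summit.BirchSwinnertonDyer.Rank1Residual.X11b.LambdaSupply
open Summit.BirchSwinnertonDyer.Rank1Residual.X11b.Halves
open Summit.BirchSwinnertonDyer.Rank1Residual.X11b
open Summit.BirchSwinnertonDyer.BirchSwinnertonDyer.Theorems.CongruentShaFreeCutLambdaSupplyAllPrimes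

/-! ## 2. The interpolation character and the character supply, at every prime `p` -/

section Supply

variable {p : ℕ} [Fact p.Prime]

/-- **THE INTERPOLATION CHARACTER at every prime `p`** (multr1-p2's
`LambdaSupply.exists_interpolationCharacter` with its `p ≠ 2` removed): for `K` imaginary quadratic,
`κ` anticyclotomic with topological generator `γ` and `ι : ℚ̄_p ≃ ℂ`, there are a Hecke character `φ`
UNRAMIFIED EVERYWHERE of infinity type `(m,−m)`, `m > 0`, and `ψ : Γ_K → ℚ̄_pˣ` with `e ∘ ψ` the
avatar of `φ` factoring through `κ`, `‖ψ(γ) − 1‖ < 1` and `ψ(γ)^{p^k} ≠ 1` for all `k`. Proof =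
theirs verbatim with `φ := λ^M` for the type-`(m₀,−m₀)` λ of `lambdaSupplyPowAt` (`m = m₀ M`).
[cite: Weil1956, §1–§2] [cite: Greenberg1987, §2] [cite: Castella2018, Thm. 3.1 (arXiv:1704.06608 p. 9)] -/
theorem exists_interpolationCharacter (ι : PadicAlgCl p ≃+* ℂ) (K : Type) [Field K]
    [NumberField K] (κ : ZpExtension K p) (hK : IsImaginaryQuadratic K) (hκ : κ.IsAnticyclotomic)
    (γ : absoluteGaloisGroup K) (hγ : κ.IsTopGenerator γ) :
    ∃ (φ : HeckeCharacter K) (m : ℕ) (ψ : absoluteGaloisGroup K →ₜ* (PadicAlgCl p)ˣ), 0 < m ∧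
      (∀ v : HeightOneSpectrum (𝓞 K), φ.IsUnramifiedAt v) ∧
      φ.HasInfinityType (fun _ ↦ (m : ℤ)) (fun _ ↦ -(m : ℤ)) ∧
      IsPAdicAvatarOf ι φ ((FramedRep.unitsContinuousMulEquivOfUnique (Fin 1) (PadicAlgCl p) :
        (PadicAlgCl p)ˣ →ₜ* GL (Fin 1) (PadicAlgCl p)).comp ψ) ∧
      FactorsThroughZp κ ((FramedRep.unitsContinuousMulEquivOfUnique (Fin 1) (PadicAlgCl p) :
        (PadicAlgCl p)ˣ →ₜ* GL (Fin 1) (PadicAlgCl p)).comp ψ) ∧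
      ‖avatarValueAt ((FramedRep.unitsContinuousMulEquivOfUnique (Fin 1) (PadicAlgCl p) :
        (PadicAlgCl p)ˣ →ₜ* GL (Fin 1) (PadicAlgCl p)).comp ψ) γ - 1‖ < 1 ∧
      ∀ k : ℕ, avatarValueAt ((FramedRep.unitsContinuousMulEquivOfUnique (Fin 1) (PadicAlgCl p) :
        (PadicAlgCl p)ˣ →ₜ* GL (Fin 1) (PadicAlgCl p)).comp ψ) γ ^ p ^ k ≠ 1 := by
  have hp : p.Prime := Fact.out
  haveI : IsTotallyComplex K := hK.2
  obtain ⟨m₀, lam, rlam, hm₀, -, hinf, -, hunr, hav, hfac⟩ := lambdaSupplyPowAt ι K κ hK hκ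
  -- rank-one currency `rlam = e ∘ ψ₀`
  set ψ₀ : absoluteGaloisGroup K →ₜ* (PadicAlgCl p)ˣ :=
    ((FramedRep.unitsContinuousMulEquivOfUnique (Fin 1) (PadicAlgCl p)).symm :
      GL (Fin 1) (PadicAlgCl p) →ₜ* (PadicAlgCl p)ˣ).comp rlam with hψ₀
  have hr : (FramedRep.unitsContinuousMulEquivOfUnique (Fin 1) (PadicAlgCl p) :
      (PadicAlgCl p)ˣ →ₜ* GL (Fin 1) (PadicAlgCl p)).comp ψ₀ = rlam := comp_symm_comp_eq rlam
  rw [← hr] at hav hfac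
  -- the exponent killing the ramification above `p`
  obtain ⟨M, hM, hunrM⟩ := exists_pow_forall_isUnramifiedAt lam
  have hfac' : ∀ n : ℕ, FactorsThroughZp κ
      ((FramedRep.unitsContinuousMulEquivOfUnique (Fin 1) (PadicAlgCl p) :
        (PadicAlgCl p)ˣ →ₜ* GL (Fin 1) (PadicAlgCl p)).comp (ψ₀ ^ n)) :=
    fun n => factorsThroughZp_unitsChar_pow κ hfac n
  have hav' : ∀ n : ℕ, IsPAdicAvatarOf ι (lam ^ n)
      ((FramedRep.unitsContinuousMulEquivOfUnique (Fin 1) (PadicAlgCl p) :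
        (PadicAlgCl p)ˣ →ₜ* GL (Fin 1) (PadicAlgCl p)).comp (ψ₀ ^ n)) :=
    fun n => isPAdicAvatarOf_pow ι hav hunr n
  have htyp : ∀ n : ℕ, (lam ^ n).HasInfinityType (fun _ ↦ ((m₀ * n : ℕ) : ℤ))
      (fun _ ↦ -((m₀ * n : ℕ) : ℤ)) := fun n => by
    have h := HasInfinityType.pow_nat hinf n
    convert h using 2 <;> push_cast <;> ring_nf
  refine ⟨lam ^ M, m₀ * M, ψ₀ ^ M, Nat.mul_pos hm₀ hM, hunrM, htyp M, hav' M, hfac' M,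
    norm_avatarValueAt_sub_one_lt hγ (hfac' M), fun k hk => ?_⟩
  -- non-torsion: suppose `x₀^{p^k} = 1`
  have hval : avatarValueAt ((FramedRep.unitsContinuousMulEquivOfUnique (Fin 1) (PadicAlgCl p) :
      (PadicAlgCl p)ˣ →ₜ* GL (Fin 1) (PadicAlgCl p)).comp (ψ₀ ^ (M * p ^ k))) γ = 1 := by
    rw [pow_mul, avatarValueAt_unitsChar_pow, hk]
  -- the character of `Γ⁻ ≅ ℤ_p` attached to `e ∘ ψ₀^{M p^k}` is trivial
  obtain ⟨χ, hχc, hχ⟩ := exists_addChar_of_factorsThroughZp (hfac' (M * p ^ k))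
  have hχ1 : χ 1 = 1 := by
    have h := hχ γ
    rw [show κ γ = Multiplicative.ofAdd 1 from hγ, toAdd_ofAdd] at h
    rw [h, hval]
  have hψ1 : ψ₀ ^ (M * p ^ k) = 1 := by
    ext σ
    have h1 := hχ σ
    rw [addChar_eq_one_of_map_one hχc hχ1, avatarValueAt_unitsChar, PadicComplex.coe_eq,
      ← map_one (algebraMap (PadicAlgCl p) ℂ_[p])] at h1
    have h2 := (algebraMap (PadicAlgCl p) ℂ_[p]).injective h1
    rw [← h2]
    simp
  -- so `λ^{M p^k}` and `1` share the avatar `e ∘ 1`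
  have hav1 : IsPAdicAvatarOf ι (lam ^ (M * p ^ k))
      ((FramedRep.unitsContinuousMulEquivOfUnique (Fin 1) (PadicAlgCl p) :
        (PadicAlgCl p)ˣ →ₜ* GL (Fin 1) (PadicAlgCl p)).comp 1) := by
    rw [← hψ1]; exact hav' _
  have heq : lam ^ (M * p ^ k) = 1 :=
    eq_of_isPAdicAvatarOf_of_isPAdicAvatarOf ι hav1 (isPAdicAvatarOf_one ι)
      (fun v hv => isUnramifiedAt_pow' (hunr v hv) _) (fun v _ => isUnramifiedAt_one' v)
  have htyp1 := htyp (M * p ^ k)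
  rw [heq] at htyp1
  have hne : ((m₀ * (M * p ^ k) : ℕ) : ℤ) ≠ 0 := by
    exact_mod_cast (Nat.mul_pos hm₀ (Nat.mul_pos hM (pow_pos hp.pos k))).ne'
  exact not_hasInfinityType_one_of_ne_zero hne htyp1

/-- **THE CHARACTER SUPPLY at every prime `p`** (the tree's `X11b.characterSupplyAt` with its
`p ≠ 2` removed; same binder shape): for every imaginary quadratic `K`, `ι : ℚ̄_p ≃ ℂ`,
anticyclotomic `κ` and `γ` with `κ γ = 1`, there are `m > 0`, `x₀ ∈ ℂ_p` and sequences `φ_k, φ'_k` of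
Hecke characters UNRAMIFIED EVERYWHERE of infinity types `(m p^k, −m p^k)`, `(2m p^k, −2m p^k)`, with
`p`-adic avatars `r_k, r'_k` through `κ` and values `r_k(γ) = x₀^{p^k}`, `r'_k(γ) = x₀^{2p^k}`,
`x₀^{p^k} ≠ 1`, `x₀^{p^k} → 1`. Proof = multr1-p1's verbatim over `exists_interpolationCharacter`.
[cite: Castella2018, Thm. 3.1 (arXiv:1704.06608 p. 9)] [cite: Washington1997, §13.1] -/
theorem characterSupplyAt :
    ∀ (K : Type) [Field K] [NumberField K] (ι : PadicAlgCl p ≃+* ℂ) (κ : ZpExtension K p)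
      (γ : Field.absoluteGaloisGroup K), IsImaginaryQuadratic K → κ.IsAnticyclotomic →
      κ.IsTopGenerator γ →
      ∃ (m : ℕ) (x₀ : ℂ_[p]) (φ φ' : ℕ → HeckeCharacter K)
        (r r' : ℕ → FramedGaloisRep K (PadicAlgCl p) 1),
        0 < m ∧ (∀ k, x₀ ^ p ^ k ≠ 1) ∧ Tendsto (fun k ↦ x₀ ^ p ^ k) atTop (𝓝 1) ∧
        (∀ k (v : HeightOneSpectrum (𝓞 K)), (φ k).IsUnramifiedAt v) ∧
        (∀ k, (φ k).HasInfinityType (fun _ ↦ ((m * p ^ k : ℕ) : ℤ))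
          (fun _ ↦ -((m * p ^ k : ℕ) : ℤ))) ∧
        (∀ k, IsPAdicAvatarOf ι (φ k) (r k)) ∧ (∀ k, FactorsThroughZp κ (r k)) ∧
        (∀ k, avatarValueAt (r k) γ = x₀ ^ p ^ k) ∧
        (∀ k (v : HeightOneSpectrum (𝓞 K)), (φ' k).IsUnramifiedAt v) ∧
        (∀ k, (φ' k).HasInfinityType (fun _ ↦ ((2 * m * p ^ k : ℕ) : ℤ))
          (fun _ ↦ -((2 * m * p ^ k : ℕ) : ℤ))) ∧
        (∀ k, IsPAdicAvatarOf ι (φ' k) (r' k)) ∧ (∀ k, FactorsThroughZp κ (r' k)) ∧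
        (∀ k, avatarValueAt (r' k) γ = x₀ ^ (2 * p ^ k)) := by
  intro K _ _ ι κ γ hK hκ hγ
  obtain ⟨φ₀, m, ψ, hm, hunr, hinf, hav, hfac, hx1, hne⟩ :=
    exists_interpolationCharacter ι K κ hK hκ γ hγ
  set e := (FramedRep.unitsContinuousMulEquivOfUnique (Fin 1) (PadicAlgCl p) :
    (PadicAlgCl p)ˣ →ₜ* GL (Fin 1) (PadicAlgCl p)) with he
  set x₀ : ℂ_[p] := avatarValueAt (e.comp ψ) γ with hx₀
  have hunr' : ∀ v : HeightOneSpectrum (𝓞 K), ((p : ℕ) : 𝓞 K) ∉ v.asIdeal → φ₀.IsUnramifiedAt v :=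
    fun v _ => hunr v
  have hpow_unr : ∀ (n : ℕ) (v : HeightOneSpectrum (𝓞 K)), (φ₀ ^ n).IsUnramifiedAt v :=
    fun n v => isUnramifiedAt_pow' (hunr v) n
  have hpow_inf : ∀ n : ℕ, (φ₀ ^ n).HasInfinityType (fun _ ↦ ((m * n : ℕ) : ℤ))
      (fun _ ↦ -((m * n : ℕ) : ℤ)) := fun n => by
    have h := HasInfinityType.pow_nat hinf n
    convert h using 2 <;> push_cast <;> ring_nf
  have hpow_av : ∀ n : ℕ, IsPAdicAvatarOf ι (φ₀ ^ n) (e.comp (ψ ^ n)) :=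
    fun n => isPAdicAvatarOf_pow ι hav hunr' n
  have hpow_fac : ∀ n : ℕ, FactorsThroughZp κ (e.comp (ψ ^ n)) :=
    fun n => factorsThroughZp_unitsChar_pow κ hfac n
  have hpow_val : ∀ n : ℕ, avatarValueAt (e.comp (ψ ^ n)) γ = x₀ ^ n :=
    fun n => avatarValueAt_unitsChar_pow ψ γ n
  refine ⟨m, x₀, fun k => φ₀ ^ p ^ k, fun k => φ₀ ^ (2 * p ^ k), fun k => e.comp (ψ ^ p ^ k),
    fun k => e.comp (ψ ^ (2 * p ^ k)), hm, hne, tendsto_pow_prime_pow_padicComplex hx1,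
    fun k v => hpow_unr _ v, fun k => hpow_inf _, fun k => hpow_av _, fun k => hpow_fac _,
    fun k => hpow_val _, fun k v => hpow_unr _ v, fun k => ?_, fun k => hpow_av _, fun k => hpow_fac _,
    fun k => hpow_val _⟩
  have h := hpow_inf (2 * p ^ k)
  convert h using 3 <;> push_cast <;> ring

end Supply

/-! ## 3. Frame rigidity at fixed periods, at every prime `p` -/

section Rigidity

variable {p : ℕ} [Fact p.Prime] {K : Type} [Field K] [NumberField K] {N : ℕ}
  {ι : PadicAlgCl p ≃+* ℂ} {𝔭 : HeightOneSpectrum (𝓞 K)} {κ : ZpExtension K p}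
  {γ : Field.absoluteGaloisGroup K} {f : CuspForm (CongruenceSubgroup.Gamma0 N) 2} {ΩK : ℂ}
  {Ωp : ℂ_[p]}

/-- The supply in the one-sequence shape of the frame-rigidity theorems, at every prime `p`:
interpolation data `(φ_k, n_k, r_k)` (unramified, type `(n_k,−n_k)`, `n_k > 0`, avatars through `κ`)
with `r_k(γ) → 1` and `r_k(γ) ≠ 1`. [cite: Castella2018, Thm. 3.1 (arXiv:1704.06608 p. 9)] -/
theorem exists_supply_tendsto (ι : PadicAlgCl p ≃+* ℂ) (κ : ZpExtension K p)
    (γ : Field.absoluteGaloisGroup K) (hK : IsImaginaryQuadratic K) (hκ : κ.IsAnticyclotomic)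
    (hγ : κ.IsTopGenerator γ) :
    ∃ (φ : ℕ → HeckeCharacter K) (n : ℕ → ℕ) (r : ℕ → FramedGaloisRep K (PadicAlgCl p) 1),
      (∀ k, 0 < n k) ∧ (∀ k (v : HeightOneSpectrum (𝓞 K)), (φ k).IsUnramifiedAt v) ∧
      (∀ k, (φ k).HasInfinityType (fun _ ↦ (n k : ℤ)) (fun _ ↦ -(n k : ℤ))) ∧
      (∀ k, IsPAdicAvatarOf ι (φ k) (r k)) ∧ (∀ k, FactorsThroughZp κ (r k)) ∧
      Tendsto (fun k ↦ avatarValueAt (r k) γ) atTop (𝓝 1) ∧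
      ∀ k, avatarValueAt (r k) γ ≠ 1 := by
  have hp : p.Prime := Fact.out
  obtain ⟨m, x₀, φ, -, r, -, hm, hne, hlim, hunr, hinf, hav, hfac, hval, -⟩ :=
    characterSupplyAt K ι κ γ hK hκ hγ
  refine ⟨φ, fun k => m * p ^ k, r, fun k => Nat.mul_pos hm (pow_pos hp.pos k), hunr, hinf, hav,
    hfac, ?_, fun k => ?_⟩
  · simpa only [hval] using hlim
  · rw [hval]; exact hne k

/-- **Frame rigidity at fixed periods for `IsBDPLFunction`, at EVERY prime `p`, UNCONDITIONAL**
(the tree's `X11b.isBDPLFunction_unique` with its `p ≠ 2` removed): over an imaginary quadratic `K`,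
for an anticyclotomic `κ` with topological generator `γ`, two series `L, L' ∈ R₀⟦T⟧` with the same
interpolation data `IsBDPLFunction ι 𝔭 κ γ f Ω_K Ω_p ·` are EQUAL.
[cite: Castella2018, Thm. 3.1 (arXiv:1704.06608 p. 9)] [cite: CastellaHsieh2018, §3.3, Def. 3.5 and Prop. 3.6] -/
theorem isBDPLFunction_unique (hK : IsImaginaryQuadratic K) (hκ : κ.IsAnticyclotomic)
    (hγ : κ.IsTopGenerator γ) {L L' : UnrSeries p} (hL : IsBDPLFunction ι 𝔭 κ γ f ΩK Ωp L)
    (hL' : IsBDPLFunction ι 𝔭 κ γ f ΩK Ωp L') : L = L' := by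
  obtain ⟨φ, n, r, hn, hunr, hinf, hav, hfac, hlim, hne⟩ := exists_supply_tendsto ι κ γ hK hκ hγ
  exact isBDPLFunction_unique_of_tendsto hL hL' hn hunr hinf hav hfac hlim
    (Frequently.of_forall hne)

/-- **"Some `L` of the frame" = "every `L` of the frame", at every prime `p`, UNCONDITIONAL.**
[cite: Castella2018, Thm. 3.1 (arXiv:1704.06608 p. 9)] -/
theorem isBDPLFunction_forall_of_exists (hK : IsImaginaryQuadratic K) (hκ : κ.IsAnticyclotomic)
    (hγ : κ.IsTopGenerator γ) {P : UnrSeries p → Prop}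
    (hex : ∃ L, IsBDPLFunction ι 𝔭 κ γ f ΩK Ωp L ∧ P L) {L' : UnrSeries p}
    (hL' : IsBDPLFunction ι 𝔭 κ γ f ΩK Ωp L') : P L' := by
  obtain ⟨L, hL, hP⟩ := hex
  rwa [isBDPLFunction_unique hK hκ hγ hL hL'] at hP

/-- **Frame rigidity at fixed periods over `𝓞_{ℂ_p}⟦T⟧`, at every prime `p`, UNCONDITIONAL** (the
tree's `X11b.R1.isBDPLFunctionInt_unique` with its `p ≠ 2` removed).
[cite: Castella2018, Thm. 3.1 (arXiv:1704.06608 p. 9)] [cite: Hsieh2014, p. 7 (arXiv:1112.1580)] -/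
theorem isBDPLFunctionInt_unique (hK : IsImaginaryQuadratic K) (hκ : κ.IsAnticyclotomic)
    (hγ : κ.IsTopGenerator γ) {Q Q' : PowerSeries 𝓞_ℂ_[p]}
    (hQ : R1.IsBDPLFunctionInt p ι 𝔭 κ γ f ΩK Ωp Q) (hQ' : R1.IsBDPLFunctionInt p ι 𝔭 κ γ f ΩK Ωp Q') :
    Q = Q' := by
  obtain ⟨φ, n, r, hn, hunr, hinf, hav, hfac, hlim, hne⟩ := exists_supply_tendsto ι κ γ hK hκ hγ
  exact R1.isBDPLFunctionInt_unique_of_tendsto hQ hQ' hn hunr hinf hav hfac hlim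
    (Frequently.of_forall hne)

/-- **"Some `Q` of the ♭-frame" = "every `Q` of the ♭-frame", at every prime `p`, UNCONDITIONAL.**
[cite: Castella2018, Thm. 3.1 (arXiv:1704.06608 p. 9)] -/
theorem isBDPLFunctionInt_forall_of_exists (hK : IsImaginaryQuadratic K) (hκ : κ.IsAnticyclotomic)
    (hγ : κ.IsTopGenerator γ) {P : PowerSeries 𝓞_ℂ_[p] → Prop}
    (hex : ∃ Q, R1.IsBDPLFunctionInt p ι 𝔭 κ γ f ΩK Ωp Q ∧ P Q) {Q' : PowerSeries 𝓞_ℂ_[p]}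
    (hQ' : R1.IsBDPLFunctionInt p ι 𝔭 κ γ f ΩK Ωp Q') : P Q' := by
  obtain ⟨Q, hQ, hP⟩ := hex
  rwa [isBDPLFunctionInt_unique hK hκ hγ hQ hQ'] at hP

end Rigidity

/-! ## 4. The `p = 2` instances, in the currency of the v5b line `two-adic-bdp-triple` -/

section Two

variable {K : Type} [Field K] [NumberField K] {N : ℕ} {ι' : PadicAlgCl 2 ≃+* ℂ}
  {v : HeightOneSpectrum (𝓞 K)} {κ : ZpExtension K 2} {γ : Field.absoluteGaloisGroup K}
  {f : CuspForm (CongruenceSubgroup.Gamma0 N) 2} {ΩK : ℂ} {Ωp : ℂ_[2]}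

/-- **RIGIDITY OF THE `2`-ADIC BDP FRAME.** In the data of (LB-wan)/(LB-bdp)
(`Theorems/CongruentShaFreeCutTwoAdicBDPTriple.lean`: `K` imaginary quadratic, `κ` the
anticyclotomic `ℤ₂`-extension with `[Fact (κ.IsTopGenerator γ)]`), two elements `L, L' ∈ R₀⟦T⟧`
of ONE frame `IsBDPLFunction ι' v κ γ f Ω_K Ω_p ·` are EQUAL: the `∀ L`-quantifier of (LB-wan) and
(LB-bdp) ranges over at most one series per `(ι', Ω_K, Ω_p)`. [cite: Castella2018, Thm. 3.1 (arXiv:1704.06608 p. 9)] -/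
theorem twoAdic_isBDPLFunction_unique (hK : IsImaginaryQuadratic K) (hκ : κ.IsAnticyclotomic)
    [hγ : Fact (κ.IsTopGenerator γ)] {L L' : UnrSeries 2} (hL : IsBDPLFunction ι' v κ γ f ΩK Ωp L)
    (hL' : IsBDPLFunction ι' v κ γ f ΩK Ωp L') : L = L' :=
  isBDPLFunction_unique hK hκ hγ.out hL hL'

/-- **At `p = 2`: a property of SOME element of a BDP frame is a property of EVERY element** — e.g.
the divisibility of (LB-wan) or the value formula of (LB-bdp) holds for every `L` of a frame as soon
as it holds for one. [cite: Castella2018, Thm. 3.1 (arXiv:1704.06608 p. 9)] -/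
theorem twoAdic_isBDPLFunction_forall_of_exists (hK : IsImaginaryQuadratic K)
    (hκ : κ.IsAnticyclotomic) [hγ : Fact (κ.IsTopGenerator γ)] {P : UnrSeries 2 → Prop}
    (hex : ∃ L, IsBDPLFunction ι' v κ γ f ΩK Ωp L ∧ P L) {L' : UnrSeries 2}
    (hL' : IsBDPLFunction ι' v κ γ f ΩK Ωp L') : P L' :=
  isBDPLFunction_forall_of_exists hK hκ hγ.out hex hL'

/-- **THE `2`-ADIC CHARACTER SUPPLY** over an imaginary quadratic `K` (e.g. a Heegner field of `E_n`
with `2` split), for the anticyclotomic `ℤ₂`-extension `κ` with topological generator `γ` and any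
`ι : ℚ̄₂ ≃ ℂ`: interpolation characters `φ_k` unramified everywhere of infinity type
`(m 2^k, −m 2^k)`, `m > 0`, with `2`-adic avatars through `κ` and values `x₀^{2^k} → 1`,
`x₀^{2^k} ≠ 1` at `γ` (and the doubled family). [cite: Castella2018, Thm. 3.1 (arXiv:1704.06608 p. 9)] -/
theorem twoAdic_characterSupplyAt (ι : PadicAlgCl 2 ≃+* ℂ) (κ : ZpExtension K 2)
    (γ : Field.absoluteGaloisGroup K) (hK : IsImaginaryQuadratic K) (hκ : κ.IsAnticyclotomic)
    (hγ : κ.IsTopGenerator γ) :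
    ∃ (m : ℕ) (x₀ : ℂ_[2]) (φ φ' : ℕ → HeckeCharacter K)
      (r r' : ℕ → FramedGaloisRep K (PadicAlgCl 2) 1),
      0 < m ∧ (∀ k, x₀ ^ 2 ^ k ≠ 1) ∧ Tendsto (fun k ↦ x₀ ^ 2 ^ k) atTop (𝓝 1) ∧
      (∀ k (v : HeightOneSpectrum (𝓞 K)), (φ k).IsUnramifiedAt v) ∧
      (∀ k, (φ k).HasInfinityType (fun _ ↦ ((m * 2 ^ k : ℕ) : ℤ))
        (fun _ ↦ -((m * 2 ^ k : ℕ) : ℤ))) ∧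
      (∀ k, IsPAdicAvatarOf ι (φ k) (r k)) ∧ (∀ k, FactorsThroughZp κ (r k)) ∧
      (∀ k, avatarValueAt (r k) γ = x₀ ^ 2 ^ k) ∧
      (∀ k (v : HeightOneSpectrum (𝓞 K)), (φ' k).IsUnramifiedAt v) ∧
      (∀ k, (φ' k).HasInfinityType (fun _ ↦ ((2 * m * 2 ^ k : ℕ) : ℤ))
        (fun _ ↦ -((2 * m * 2 ^ k : ℕ) : ℤ))) ∧
      (∀ k, IsPAdicAvatarOf ι (φ' k) (r' k)) ∧ (∀ k, FactorsThroughZp κ (r' k)) ∧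
      (∀ k, avatarValueAt (r' k) γ = x₀ ^ (2 * 2 ^ k)) :=
  characterSupplyAt K ι κ γ hK hκ hγ

end Two

end Summit.BirchSwinnertonDyer.BirchSwinnertonDyer.Theorems.CongruentShaFreeCutCharacterSupply

end
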